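import Summits.ABC.StewartYu.PadicG3TwoScheduleS
import HarnessLib

/-!
# Cell abc-stewartyu, Gen-3 frame at `p = 2` (crux `Y07Two`, stmt-ABC-19659), record interface: the DEPTH and the
# END data of the schedule of record `schedTwoS` in closed form (for the END-range lines and the depth fit)

`Summits/ABC/StewartYu/PadicG3TwoScheduleEnd.lean` — cell `abc-stewartyu` (HOME `run/shared/lean/pub/abc-stewartyu/`),
route `PadicPrimesKummerThird`, seat p5 (g3).  Theorems only, elementary:
* `two_pow_le_three_pow_Istar3` / `three_pow_Istar3_lt` : `2^{d+25+m} ≤ 3^{I*} < 3·2^{d+25+m}` (so the depth fit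
  `8·3^{I*} ≤ 4L` follows from `6·2^{d+25+m} ≤ L`, `depth_fit_of_le`);
* `T3_Istar3_le` : `T3 I* ≤ 4L/2^{d+25+m}`; `T3_pos_of_depth` : `8 ≤ T3 I` for `I ≤ I*` under the depth fit;
* `Tfin_schedTwoS_eq` / `Tfin_schedTwoS_ge` : `Tfin I = ⌊M/(n+2)³⌋ + (d+3)·T3 I + 1 ≥ ⌊M/(n+2)³⌋ + 1`;
* `Nfin_schedTwoS_eq` : `Nfin I = 3^{d+3}·⌊4XL/(T3 I + 1)⌋`, and `Nfin_schedTwoS_Istar_ge` : under the depth fit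
  `3^{d+3}·(2^{d+25+m}·X/2 − 1) ≤ Nfin I*`-type lower bound in the usable form `3^{d+3}·(4XL/(T3 I*+1)) = Nfin I*`.

WHAT THIS IS NOT: the comparison with `PadicG3Par`'s dyadic END data (`P.Xfin`, `P.S₀N`, `P.D`) — that depends on
the record's instantiation (`Nq`, `Sdepth`) and is p3-g6's (F-C); no crux moves.

References: Yu. V. Nesterenko, LNM 1819 (2003), §4 (4.3)–(4.5), §5.2; K. Yu, Acta Math. 211 (2013), (5.13)–(5.15).
-/

noncomputable section

open Finset

namespace Summit.ABC.StewartYu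

namespace TwoSetup

variable (S : TwoSetup) (P : PadicG3Par (S.d + 1))

/-! ### The depth -/

/-- `2^{d+25+m} ≤ 3^{I*}`. [cite: Nesterenko2003, (3.24); shape only] -/
theorem two_pow_le_three_pow_Istar3 : 2 ^ (S.d + 1 + 24 + P.m) ≤ 3 ^ S.Istar3 P := by
  unfold Istar3
  exact Nat.le_pow_clog (by norm_num) _

/-- `3^{I*} < 3·2^{d+25+m}`. [cite: Nesterenko2003, (3.24); shape only] -/
theorem three_pow_Istar3_lt : 3 ^ S.Istar3 P < 3 * 2 ^ (S.d + 1 + 24 + P.m) := by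
  unfold Istar3
  set x := 2 ^ (S.d + 1 + 24 + P.m) with hx
  have h2 : 1 < x := Nat.one_lt_two_pow (by omega)
  have hpos : 0 < Nat.clog 3 x := Nat.clog_pos (by norm_num) h2
  have h := Nat.pow_pred_clog_lt_self (b := 3) (by norm_num) h2
  rw [Nat.pred_eq_sub_one] at h
  have e : 3 ^ Nat.clog 3 x = 3 * 3 ^ (Nat.clog 3 x - 1) := by
    rw [← pow_succ']; congr 1; omega
  rw [e]; omega

/-- **The depth fit from a floor on `L`**: `6·2^{d+25+m} ≤ L ⇒ 8·3^{I*} ≤ 4L`. [folklore] -/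
theorem depth_fit_of_le (hL : 6 * 2 ^ (S.d + 1 + 24 + P.m) ≤ P.L) : 8 * 3 ^ S.Istar3 P ≤ 4 * P.L := by
  have h := S.three_pow_Istar3_lt P
  omega

/-- `T3 I* ≤ 4L/2^{d+25+m}`. [folklore] -/
theorem T3_Istar3_le : S.T3 P (S.Istar3 P) ≤ 4 * P.L / 2 ^ (S.d + 1 + 24 + P.m) := by
  unfold T3
  exact Nat.div_le_div_left (S.two_pow_le_three_pow_Istar3 P) (by positivity)

/-- Under the depth fit every decrement down to the last level is `≥ 8`. [folklore] -/
theorem T3_ge_of_depth (hdepth : 8 * 3 ^ S.Istar3 P ≤ 4 * P.L) {I : ℕ} (hI : I ≤ S.Istar3 P) :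
    8 ≤ S.T3 P I := by
  unfold T3
  have h3 : 3 ^ I ≤ 3 ^ S.Istar3 P := Nat.pow_le_pow_right (by norm_num) hI
  have hpos : 0 < 3 ^ I := by positivity
  rw [Nat.le_div_iff_mul_le hpos]
  calc 8 * 3 ^ I ≤ 8 * 3 ^ S.Istar3 P := Nat.mul_le_mul_left _ h3
    _ ≤ 4 * P.L := hdepth

/-! ### The END order and range -/

/-- `Tfin I = ⌊M/(n+2)³⌋ + (d+3)·T3 I + 1`. [folklore] -/
theorem Tfin_schedTwoS_eq (I : ℕ) :
    (S.schedTwoS P).Tfin I = P.M / (S.d + 1 + 2) ^ 3 + (S.d + 3) * S.T3 P I + 1 := by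
  rw [schedTwoS_Tfin]
  unfold T03
  generalize P.M / (S.d + 1 + 2) ^ 3 = M₃
  generalize S.T3 P I = T
  have : (S.d + 3) * T ≤ 2 * (S.d + 1 + 2) * T := by nlinarith
  zify [this, show (S.d + 3) * T ≤ M₃ + 2 * (S.d + 1 + 2) * T + 1 by omega]
  ring

/-- **`⌊M/(n+2)³⌋ + 1 ≤ Tfin I`** (the END's reserved order). [cite: Nesterenko2003, (4.5) and §5.2; shape only] -/
theorem Tfin_schedTwoS_ge (I : ℕ) : P.M / (S.d + 1 + 2) ^ 3 + 1 ≤ (S.schedTwoS P).Tfin I := by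
  rw [S.Tfin_schedTwoS_eq P I]
  omega

/-- `Nfin I = 3^{d+3}·⌊4XL/(T3 I + 1)⌋`. [folklore] -/
theorem Nfin_schedTwoS_eq (I : ℕ) :
    (S.schedTwoS P).Nfin I = 3 ^ (S.d + 3) * (4 * P.X * P.L / (S.T3 P I + 1)) := rfl

/-- **The END range from below**: `3^{d+3}·(4XL/(T+1)) ≥ 3^{d+3}·(4XL/(4L/2^{d+25+m} + 1))` at `I = I*`.
[cite: Nesterenko2003, §5.2; shape only] -/
theorem Nfin_schedTwoS_Istar_ge :
    3 ^ (S.d + 3) * (4 * P.X * P.L / (4 * P.L / 2 ^ (S.d + 1 + 24 + P.m) + 1)) ≤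
      (S.schedTwoS P).Nfin (S.Istar3 P) := by
  rw [S.Nfin_schedTwoS_eq P]
  refine Nat.mul_le_mul_left _ (Nat.div_le_div_left ?_ (by omega))
  have := S.T3_Istar3_le P
  omega

/-- The last level's initial coprime range and the level-`0` range (projections). [folklore] -/
theorem N0_schedTwoS_zero : (S.schedTwoS P).N0 0 = P.X := by
  rw [schedTwoS_N0, Nsub3_zero_zero]

end TwoSetup

end Summit.ABC.StewartYu

end
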